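/-
Copyright: cell pub-balaban-gaps (YM BLITZ Y1, track G1), seat g1-p2 GEN 7 (unit `pub-balaban-gaps-g1-p2`).  Row (D4) NODE O,
OBJECT level, part 1 of 2 of the covariant shift ([B9] (3.50)–(3.54)): the GEOMETRY of one fine step on the unit cube torus and the
FIBRED site-local ∕ backward-shift operators on `Site P 0 × F` with their block letters (a site-local fibre coefficient is cube-local
with diagonal block bound = its fibre row mass; a decaying block letter survives the one-step relabelling `S⁻_μ` at the price `e^{ρ}`).
Part 2 (`D4WalkBlockCovariantShift`) assembles `V_W = Δ_1 ⊗ 1 − Δ_W` and Cor. 3.5's step.  HONEST FRAMING: elementary bookkeeping on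
the tree's torus carriers; nothing of Bałaban's asserted; (D4) instance 0∕1; NOT BetaPertH, NOT continuum, NOT Clay.
-/
import Summits.QuantumFields.BalabanUV.Gaps.D4WalkBlockDerivative
import Summits.QuantumFields.BalabanUV.Gaps.D4WalkBlockFlatLetters

/-!
# `Gaps.D4WalkBlockCovariantGeometry` — one fine step moves the unit cube by at most one; site-local fibre coefficients and the
# backward shift in block currency (cell pub-balaban-gaps, seat g1-p2 gen 7)

HONEST DEPENDENCY (cell pub-balaban, verbatim): continuum YM on T⁴ ⇐ BetaPertH ∧ nine spine estimates (0/9 proved);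
BetaPertH ⇐ (D1) ∧ (D4) ∧ CAP+tail.

* §1 `blk_shift_val_cases` (the block index of `x + e_μ`: `+0`, `+1`, or wrapped from the last block to `0`), `circAbs_le_one_of`,
  **`tdist1_cubeOf_shift_le`** ∕ **`tdist1_cubeOf_unshift_le`** (`d₁(cube(x ± e_μ), cube(x)) ≤ 1` on `UT (Nv P K)`), `shift_unshift`.
* §2 `fibDiag w` (`[x = y]·w(x)_{ab}` — print's fibrewise `i ad_{A′(b)}`, `F′_{1,k}(i ad)` at a site), `differentiableOn_fibDiag_entry`,
  `fibDiag_local` (cube-local), `blockNorm_fibDiag_le` (diagonal block bound = fibre row mass); `SBf μ` (`(S⁻λ)(x,a) = λ(x − e_μ, a)`),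
  `SBf_mul_apply`, **`blockNorm_SBf_mul_le`** (`‖M‖_{Y,Y′} ≤ Ae^{−ρd₁}` ⟹ `‖S⁻_μM‖_{Y,Y′} ≤ Ae^{ρ}e^{−ρd₁}`).
References: T. Bałaban, Comm. Math. Phys. **99** (1985) 389–434 [B9], (3.50)–(3.52) p. 400; Comm. Math. Phys. **96** (1984) [4] p. 235.
-/

noncomputable section

namespace Summit.QuantumFields.BalabanUV.Gaps.D4WalkBlockCovariantGeometry

open Metric Set Finset
open scoped Matrix
open Literature.MathematicalPhysics.QuantumFieldTheory.Balaban1983to89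
open Literature.MathematicalPhysics.QuantumFieldTheory.Balaban1983to89.B9SectDWalk (DomBy)
open Literature.MathematicalPhysics.QuantumFieldTheory.Balaban1983to89.B9Thm34Ext (toB6)
open Literature.MathematicalPhysics.QuantumFieldTheory.Balaban1983to89.B9Thm37GlueTorus (torusGeom tdist1 tdist1_nonneg tdist1_comm)
open Literature.MathematicalPhysics.QuantumFieldTheory.Balaban1983to89.TreeLengthTorus (TPt)
open Literature.MathematicalPhysics.QuantumFieldTheory.Balaban1983to89.B5TorusCover (UT)
open Literature.MathematicalPhysics.QuantumFieldTheory.Balaban1983to89.B11SectG (RowSum)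
open Literature.MathematicalPhysics.QuantumFieldTheory.Balaban1983to89.B5Ineq137Torus (toT Nv blk blk_val)
open Literature.MathematicalPhysics.QuantumFieldTheory.Balaban1983to89.B4TorusKernel.MultiPeriod
  (circAbs circAbs_le_abs circAbs_add_mul circAbs_nonneg)
open Literature.MathematicalPhysics.QuantumFieldTheory.Balaban1983to89.B6Prop22OneScaleTorus (Index)
open Literature.MathematicalPhysics.QuantumFieldTheory.Balaban1983to89.B1RG242Torus (tower deriv)
open Summit.QuantumFields.BalabanUV.Gaps.D4WalkBlock
  (rowMass blockNorm blockNorm_nonneg rowMass_le_blockNorm blockNorm_le_of_rowMass_le BlockWalkExpansion)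
open Summit.QuantumFields.BalabanUV.Gaps.D4WalkBlockDerivative
  (blockDominated_of_local differentiableOn_perturb_entry blockWalkExpansion_perturb_of_derivLetters)
open Summit.QuantumFields.BalabanUV.Gaps.D4WalkBlockFlatLetters (cubeOf blockWalkExpansion_const)

/-! ## §1. Geometry: one fine step moves the unit cube by at most one -/

section Geometry

variable (P : Params)

/-- `circAbs n z ≤ 1` for `z ∈ {0, 1, −1, 1 − n, n − 1}`. -/
theorem circAbs_le_one_of {n : ℕ} (hn : 1 ≤ n) {z : ℤ} (hz : z = 0 ∨ z = 1 ∨ z = -1 ∨ z = 1 - n ∨ z = n - 1) :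
    circAbs n z ≤ 1 := by
  rcases hz with h | h | h | h | h
  · rw [h]; exact (circAbs_le_abs hn 0).trans (by simp)
  · rw [h]; exact (circAbs_le_abs hn 1).trans (by simp)
  · rw [h]; exact (circAbs_le_abs hn (-1)).trans (by simp)
  · rw [h, show (1 : ℤ) - n = 1 + n * (-1) by ring, circAbs_add_mul]; exact (circAbs_le_abs hn 1).trans (by simp)
  · rw [h, show (n : ℤ) - 1 = -1 + n * 1 by ring, circAbs_add_mul]; exact (circAbs_le_abs hn (-1)).trans (by simp)

/-- The block index of `x + e_μ` in direction `μ`: `+0`, `+1`, or wrapped from the last block to `0`. -/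
theorem blk_shift_val_cases (x : Site P 0) (μ : Fin P.d) :
    (blk P P.K (Site.shift x μ) μ).val = (blk P P.K x μ).val ∨
      (blk P P.K (Site.shift x μ) μ).val = (blk P P.K x μ).val + 1 ∨
      ((blk P P.K (Site.shift x μ) μ).val = 0 ∧ (blk P P.K x μ).val = P.sitesPerDir P.K - 1) := by
  have hK : P.K ≤ P.m + P.K := Nat.le_add_left _ _
  have hL : 0 < P.L ^ P.K := pow_pos P.L_pos _
  have hNN : P.L ^ P.K * P.sitesPerDir P.K = P.sitesPerDir 0 := B5Ineq137Torus.pow_mul_sitesPerDir P hK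
  have hNK1 : 1 ≤ P.sitesPerDir P.K := Nat.one_le_iff_ne_zero.2 (P.sitesPerDir_ne_zero _)
  have hv : (x μ).val < P.sitesPerDir 0 := ZMod.val_lt _
  have hsh : Site.shift x μ μ = x μ + 1 := by unfold Site.shift; rw [Function.update_self]
  rw [blk_val P hK, blk_val P hK, hsh]
  rcases Nat.lt_or_ge ((x μ).val + 1) (P.sitesPerDir 0) with hlt | hge
  · have hval : (x μ + 1).val = (x μ).val + 1 := by
      rw [ZMod.val_add, ZMod.val_one_eq_one_mod, Nat.add_mod_mod, Nat.mod_eq_of_lt hlt]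
    rw [hval, Nat.succ_div]
    by_cases hd : P.L ^ P.K ∣ (x μ).val + 1
    · right; left; rw [if_pos hd]
    · left; rw [if_neg hd, add_zero]
  · have hval0 : (x μ).val = P.sitesPerDir 0 - 1 := by omega
    have hval : (x μ + 1).val = 0 := by
      rw [ZMod.val_add, ZMod.val_one_eq_one_mod, Nat.add_mod_mod, hval0, Nat.sub_add_cancel (by omega), Nat.mod_self]
    right; right
    refine ⟨by rw [hval, Nat.zero_div], ?_⟩
    rw [hval0]
    refine Nat.div_eq_of_lt_le ?_ ?_
    · rw [← hNN, Nat.sub_mul, one_mul, mul_comm]; exact Nat.sub_le_sub_left (Nat.one_le_iff_ne_zero.2 hL.ne') _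
    · rw [Nat.sub_add_cancel hNK1, ← hNN, mul_comm]; exact Nat.sub_lt (by rw [mul_comm, hNN]; omega) one_pos

/-- **ONE FINE STEP FORWARD MOVES THE CUBE BY AT MOST ONE**: `d₁(cube(x + e_μ), cube(x)) ≤ 1`. -/
theorem tdist1_cubeOf_shift_le (x : Site P 0) (μ : Fin P.d) :
    tdist1 (Nv P P.K) (cubeOf P (Site.shift x μ)) (cubeOf P x) ≤ 1 := by
  have hNK1 : 1 ≤ P.sitesPerDir P.K := Nat.one_le_iff_ne_zero.2 (P.sitesPerDir_ne_zero _)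
  unfold tdist1 cubeOf
  simp only [UT.toSite_ofSite]
  rw [← Finset.add_sum_erase _ _ (Finset.mem_univ μ)]
  have hrest : ∑ i ∈ Finset.univ.erase μ, ((B4Sect5Torus.ccoord (Nv P P.K) (toT (blk P P.K (Site.shift x μ)))
      (toT (blk P P.K x)) i : ℕ) : ℝ) = 0 := by
    refine Finset.sum_eq_zero fun i hi => ?_
    have hiμ : i ≠ μ := Finset.ne_of_mem_erase hi
    have e : blk P P.K (Site.shift x μ) i = blk P P.K x i := by
      unfold blk Site.shift; rw [Function.update_of_ne hiμ]
    have : B4Sect5Torus.ccoord (Nv P P.K) (toT (blk P P.K (Site.shift x μ))) (toT (blk P P.K x)) i = 0 := by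
      have h := B4Sect5Torus.ccoord_self (Nv P P.K) (toT (blk P P.K x)) i
      simp only [B4Sect5Torus.ccoord, toT, e] at h ⊢
      exact h
    rw [this, Nat.cast_zero]
  rw [hrest, add_zero]
  have hc : circAbs (Nv P P.K μ) ((((blk P P.K (Site.shift x μ) μ).val : ℕ) : ℤ) - (((blk P P.K x μ).val : ℕ) : ℤ)) ≤ 1 := by
    refine circAbs_le_one_of hNK1 ?_
    rcases blk_shift_val_cases P x μ with h | h | ⟨h1, h2⟩
    · left; rw [h]; ring
    · right; left; rw [h]; push_cast; ring
    · right; right; right; left; rw [h1, h2]; push_cast [hNK1]; simp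
  have h0 := circAbs_nonneg hNK1 ((((blk P P.K (Site.shift x μ) μ).val : ℕ) : ℤ) - (((blk P P.K x μ).val : ℕ) : ℤ))
  have : (circAbs (Nv P P.K μ) ((((blk P P.K (Site.shift x μ) μ).val : ℕ) : ℤ) -
      (((blk P P.K x μ).val : ℕ) : ℤ))).toNat ≤ 1 := by
    have : (Nv P P.K μ) = P.sitesPerDir P.K := rfl
    omega
  simp only [B4Sect5Torus.ccoord, toT]
  exact_mod_cast this

variable {P}

/-- `(x − e_μ) + e_μ = x`. -/
theorem shift_unshift (x : Site P 0) (μ : Fin P.d) : Site.shift (Site.unshift x μ) μ = x := by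
  unfold Site.shift Site.unshift
  funext i
  by_cases h : i = μ
  · subst h; simp
  · simp [Function.update_of_ne h]

/-- **ONE FINE STEP BACKWARD MOVES THE CUBE BY AT MOST ONE**. -/
theorem tdist1_cubeOf_unshift_le (x : Site P 0) (μ : Fin P.d) :
    tdist1 (Nv P P.K) (cubeOf P (Site.unshift x μ)) (cubeOf P x) ≤ 1 := by
  have h := tdist1_cubeOf_shift_le P (Site.unshift x μ) μ
  rw [shift_unshift] at h
  rwa [tdist1_comm]

end Geometry

/-! ## §2. Fibred operators: site-local fibre coefficients, the backward shift and its relabelled letter -/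

section Fibred

variable (P : Params) (F : Type) [Fintype F] [DecidableEq F]

/-- A SITE-LOCAL FIBRE COEFFICIENT: `(fibDiag w)((x,a),(y,b)) = [x = y]·w(x)_{ab}` (print: `i ad_{A′(b)}`, `i ad_{(∇*A)(x)}`,
`F′_{1,k}(i ad_{A′(b)})` acting in 𝔤 at the site `x`). [cite: Balaban1985BackgroundPropagators, (3.52) p.400] -/
def fibDiag (w : Site P 0 → Matrix F F ℂ) : Matrix (Site P 0 × F) (Site P 0 × F) ℂ :=
  Matrix.of fun p q => if p.1 = q.1 then w p.1 p.2 q.2 else 0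

/-- The fibred BACKWARD shift: `(S⁻_μλ)(x, a) = λ(x − e_μ, a)`. -/
def SBf (μ : Fin P.d) : Matrix (Site P 0 × F) (Site P 0 × F) ℂ :=
  Matrix.of fun p q => if q = (Site.unshift p.1 μ, p.2) then 1 else 0

variable {P F}

omit [Fintype F] [DecidableEq F] in
/-- Entries of a site-local fibre coefficient family are holomorphic when the fibre entries are. -/
theorem differentiableOn_fibDiag_entry {E : Type*} [NormedAddCommGroup E] [NormedSpace ℂ E] {s : Set E}
    {w : E → Site P 0 → Matrix F F ℂ} (hw : ∀ x a b, DifferentiableOn ℂ (fun u => w u x a b) s) (p q : Site P 0 × F) :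
    DifferentiableOn ℂ (fun u => fibDiag P F (w u) p q) s := by
  unfold fibDiag
  simp only [Matrix.of_apply]
  split_ifs
  · exact hw _ _ _
  · exact differentiableOn_const _

omit [Fintype F] [DecidableEq F] in
/-- `fibDiag w` is cube-local for every cube map factoring through the site. -/
theorem fibDiag_local {Kt : Type} (cub : Site P 0 → Kt) (w : Site P 0 → Matrix F F ℂ) (p q : Site P 0 × F)
    (h : fibDiag P F w p q ≠ 0) : cub p.1 = cub q.1 := by
  unfold fibDiag at h
  rw [Matrix.of_apply] at h
  by_cases hpq : p.1 = q.1
  · rw [hpq]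
  · exact (h (if_neg hpq)).elim

omit [DecidableEq F] in
/-- The diagonal blocks of `fibDiag w` are bounded by the fibre row masses `Σ_b ‖w(x)_{ab}‖ ≤ β`. -/
theorem blockNorm_fibDiag_le {ν : ℕ} {Kv : Fin ν → ℕ} (cub : Site P 0 → UT Kv) (w : Site P 0 → Matrix F F ℂ) {β : ℝ}
    (hβ : 0 ≤ β) (hw : ∀ x a, ∑ b, ‖w x a b‖ ≤ β) (Y : UT Kv) :
    blockNorm (fun p : Site P 0 × F => cub p.1) (fun p : Site P 0 × F => cub p.1) (fibDiag P F w) Y Y ≤ β := by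
  classical
  refine blockNorm_le_of_rowMass_le _ _ _ Y Y hβ fun p _ => ?_
  unfold rowMass
  calc ∑ q ∈ Finset.univ.filter (fun q : Site P 0 × F => cub q.1 = Y), ‖fibDiag P F w p q‖
      ≤ ∑ q : Site P 0 × F, ‖fibDiag P F w p q‖ :=
        Finset.sum_le_sum_of_subset_of_nonneg (Finset.filter_subset _ _) fun _ _ _ => norm_nonneg _
    _ = ∑ q : Site P 0 × F, if p.1 = q.1 then ‖w p.1 p.2 q.2‖ else 0 := by
        refine Finset.sum_congr rfl fun q _ => ?_
        unfold fibDiag; rw [Matrix.of_apply]; split_ifs <;> simp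
    _ = ∑ x : Site P 0, ∑ b : F, (if p.1 = x then ‖w p.1 p.2 b‖ else 0) := Fintype.sum_prod_type _
    _ = ∑ b : F, ‖w p.1 p.2 b‖ := by
        rw [Finset.sum_comm]
        exact Finset.sum_congr rfl fun b _ => by rw [Finset.sum_ite_eq]; simp
    _ ≤ β := hw p.1 p.2

omit [Fintype F] [DecidableEq F] in
/-- `fibDiag` is additive. -/
theorem fibDiag_add (w w' : Site P 0 → Matrix F F ℂ) :
    fibDiag P F (fun x => w x + w' x) = fibDiag P F w + fibDiag P F w' := by
  ext p q; simp only [fibDiag, Matrix.of_apply, Matrix.add_apply]; split_ifs <;> simp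

omit [Fintype F] [DecidableEq F] in
/-- `fibDiag` commutes with scalars. -/
theorem fibDiag_smul (c : ℂ) (w : Site P 0 → Matrix F F ℂ) : fibDiag P F (fun x => c • w x) = c • fibDiag P F w := by
  ext p q; simp only [fibDiag, Matrix.of_apply, Matrix.smul_apply, smul_eq_mul]; split_ifs <;> simp

omit [Fintype F] [DecidableEq F] in
/-- `fibDiag` commutes with finite sums. -/
theorem fibDiag_sum {ι : Type*} (s : Finset ι) (w : ι → Site P 0 → Matrix F F ℂ) :
    fibDiag P F (fun x => ∑ i ∈ s, w i x) = ∑ i ∈ s, fibDiag P F (w i) := by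
  ext p q
  simp only [fibDiag, Matrix.of_apply, Matrix.sum_apply]
  split_ifs with h
  · rfl
  · simp

/-- Rows of `S⁻_μ·M` are rows of `M` one fine step back. -/
theorem SBf_mul_apply (μ : Fin P.d) (M : Matrix (Site P 0 × F) (Site P 0 × F) ℂ) (p q : Site P 0 × F) :
    (SBf P F μ * M) p q = M (Site.unshift p.1 μ, p.2) q := by
  rw [Matrix.mul_apply]
  unfold SBf
  simp only [Matrix.of_apply, ite_mul, one_mul, zero_mul]
  rw [Finset.sum_ite_eq' Finset.univ (Site.unshift p.1 μ, p.2) (fun r => M r q)]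
  simp

/-- **A DECAYING BLOCK LETTER SURVIVES THE ONE-STEP RELABELLING** at the price `e^{ρ}`: `‖M‖_{Y,Y′} ≤ Ae^{−ρd₁(Y,Y′)}` for all cubes
(`A, ρ ≥ 0`) ⟹ `‖S⁻_μM‖_{Y,Y′} ≤ Ae^{ρ}·e^{−ρd₁(Y,Y′)}` (the rows move by one fine site, hence by at most one cube, §1). -/
theorem blockNorm_SBf_mul_le (μ : Fin P.d) (M : Matrix (Site P 0 × F) (Site P 0 × F) ℂ) {A ρ : ℝ} (hA : 0 ≤ A) (hρ : 0 ≤ ρ)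
    (hM : ∀ Y Y', blockNorm (fun p : Site P 0 × F => cubeOf P p.1) (fun p : Site P 0 × F => cubeOf P p.1) M Y Y' ≤
      A * Real.exp (-(ρ * tdist1 (Nv P P.K) Y Y')))
    (Y Y' : UT (Nv P P.K)) :
    blockNorm (fun p : Site P 0 × F => cubeOf P p.1) (fun p : Site P 0 × F => cubeOf P p.1) (SBf P F μ * M) Y Y' ≤
      (A * Real.exp ρ) * Real.exp (-(ρ * tdist1 (Nv P P.K) Y Y')) := by
  refine blockNorm_le_of_rowMass_le _ _ _ Y Y' (by positivity) fun p hp => ?_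
  have e : rowMass (fun p : Site P 0 × F => cubeOf P p.1) (SBf P F μ * M) p Y' =
      rowMass (fun p : Site P 0 × F => cubeOf P p.1) M (Site.unshift p.1 μ, p.2) Y' := by
    unfold rowMass
    exact Finset.sum_congr rfl fun q _ => by rw [SBf_mul_apply]
  rw [e]
  set Y'' := cubeOf P (Site.unshift p.1 μ) with hY''
  have h1 : tdist1 (Nv P P.K) Y'' Y ≤ 1 := by rw [hY'', ← hp]; exact tdist1_cubeOf_unshift_le p.1 μ
  have h2 : tdist1 (Nv P P.K) Y Y' ≤ 1 + tdist1 (Nv P P.K) Y'' Y' := by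
    have := B9Thm37GlueTorus.tdist1_triangle (N := Nv P P.K) Y Y'' Y'
    rw [tdist1_comm Y Y''] at this
    linarith
  calc rowMass (fun p : Site P 0 × F => cubeOf P p.1) M (Site.unshift p.1 μ, p.2) Y'
      ≤ blockNorm (fun p : Site P 0 × F => cubeOf P p.1) (fun p : Site P 0 × F => cubeOf P p.1) M Y'' Y' :=
        rowMass_le_blockNorm _ _ M _ Y'
    _ ≤ A * Real.exp (-(ρ * tdist1 (Nv P P.K) Y'' Y')) := hM Y'' Y'
    _ ≤ (A * Real.exp ρ) * Real.exp (-(ρ * tdist1 (Nv P P.K) Y Y')) := by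
        rw [mul_assoc, ← Real.exp_add]
        exact mul_le_mul_of_nonneg_left (Real.exp_le_exp.2 (by nlinarith)) hA

end Fibred

end Summit.QuantumFields.BalabanUV.Gaps.D4WalkBlockCovariantGeometry

end
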